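import Mathlib.Tactic.Linarith
import Summits.CriticalPhenomena.PercolationContinuityZ3.Theorems.PercNearOneGluingNoHeavyLowerTailSahiCTCNcGen
import Summits.CriticalPhenomena.PercolationContinuityZ3.Theorems.PercNearOneGluingNoHeavyLowerTailSahiCTCHarrisBlock
import HarnessLib

/-!
# `NoHeavyLowerTail` (crux stmt-CriticalPhenomena-4575), P3 lane: the LEVEL SPLIT of the generic certificate polynomial —
# `Ñ_c = Π·T_c + e_c·R_c` with two three-factor forms, and the reduction "`T_c, R_c ∈ ℕ[r]` ⇒ `Ñ_c ∈ ℕ[r]`"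

Support file (seat `prim-l12-p3`, gen 23; `--supports stmt-CriticalPhenomena-4575`).  Memo
`run/shared/lean/prim/prim-l12/FROM-prim-l12-p3-g23-LEVEL-SPLIT.md`.  Companion of `…SahiCTCNcGen` (the generic level-`c` polynomial
`Ñ_c = Ngen c` of memo g9 §1, whose nonnegativity at the odds vector is the (TC) row of the threshold certificate `ρ_c`, `…SahiAllButC`).

With the level-`c` dictionary of `…SahiCTCNcGen` (`h_K = GF(faces of size ≤ c)`, `t_K = GF(faces of size > c)`, `h_Y` = common faces of
size `≤ c`, `e_Y` = common `c`-faces, `Θ_c`, `D_c`, `e_c`, `Π`) define the two THREE-factor forms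
  `T_c(K_X,K_Z) := e_c·(Π·h_Y − h_X·h_Z) − Θ_c·D_c·e_Y`       (`TcForm`: "Harris for the `c`-skeleta, with a margin for the common top faces"),
  `R_c(K_X,K_Z) := D_c·(Π·h_Y − K_X·K_Z) + Π·t_X·t_Z`         (`RcForm`: "the Harris deficit of dropping the big common faces is paid by the big faces").
THIS FILE proves the polynomial identity
  `Ñ_c(K_X,K_Z) = Π·T_c(K_X,K_Z) + e_c·R_c(K_X,K_Z)`          (`Ngen_eq_split`, every `c`, every pair of families)
and the reduction `coeff_Ngen_nonneg_of_split`: if `T_c` and `R_c` have nonnegative coefficients then so has `Ñ_c` (hence the (TC) row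
holds at every nonnegative odds vector).  The CONJECTURE (LS_c) "`T_c, R_c ∈ ℕ[r]` for every pair of complexes" is supported by an
exact census (memo §2: exhaustive on four points for every `c`, structured and random pairs on `k ≤ 8` points, 0 negatives) and would give
the coefficientwise threshold certificate CTC_c(k) for every `c, k` — in particular the open c = 2 case for every `k`, and, through the
complement duality `c ↔ k − c` (memo §1), the slot "at least two of `k` open" for every `k`.  Also here: the easy partial results
`coeff_TcForm_nonneg_of_commonEQ_empty` (`T_c ≥ 0` when the complexes share no `c`-face: `T_c = e_c·Harris`) and
`coeff_RcForm_nonneg_of_facesGT_empty` (`R_c ≥ 0` when neither complex has a face of size `> c`: `R_c = D_c·Harris`), both from the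
Harris block `…SahiCTCHarrisBlock.coeff_harris_sub_nonneg`.  Nothing is asserted about the crux; no positivity of `Ñ_c` is claimed here.
-/

namespace Summit.CriticalPhenomena.PercolationContinuityZ3.Theorems.SahiCTCForms

open Finset MvPolynomial SahiCTCGenFun

variable {α : Type*} [DecidableEq α] [Fintype α]

/-! ### The two three-factor forms -/

/-- **`T_c(K_X,K_Z) := e_c·(Π·h_Y − h_X·h_Z) − Θ_c·D_c·e_Y`** (memo g23 §1). [this work] -/
noncomputable def TcForm (c : ℕ) (KX KZ : Finset (Finset α)) : MvPolynomial α ℤ :=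
  ee c * (PiP * gf (commonLE c KX KZ) - gf (facesLE c KX) * gf (facesLE c KZ)) - ThC c * DdC c * gf (commonEQ c KX KZ)

/-- **`R_c(K_X,K_Z) := D_c·(Π·h_Y − K_X·K_Z) + Π·t_X·t_Z`** (memo g23 §1). [this work] -/
noncomputable def RcForm (c : ℕ) (KX KZ : Finset (Finset α)) : MvPolynomial α ℤ :=
  DdC c * (PiP * gf (commonLE c KX KZ) - gf KX * gf KZ) + PiP * gf (facesGT c KX) * gf (facesGT c KZ)

/-! ### Splitting a family and the whole power set at level `c` -/

/-- `K = h_K ⊔ t_K`: a family splits into its members of size `≤ c` and `> c`. [this work] -/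
theorem gf_eq_facesLE_add_facesGT (c : ℕ) (K : Finset (Finset α)) : gf K = gf (facesLE c K) + gf (facesGT c K) := by
  rw [← gf_union]
  · congr 1
    ext S
    simp only [facesLE, facesGT, mem_union, mem_filter, mem_powerset, subset_univ, true_and]
    constructor
    · intro h
      by_cases hc : #S ≤ c
      · exact Or.inl ⟨hc, h⟩
      · exact Or.inr ⟨by omega, h⟩
    · rintro (⟨_, h⟩ | ⟨_, h⟩) <;> exact h
  · rw [disjoint_left]
    intro S h1 h2
    have := (mem_filter.1 h1).2.1
    have := (mem_filter.1 h2).2.1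
    omega

/-- `Π = Θ_c + D_c` on any finite type. [this work] -/
theorem PiP_eq_ThC_add_DdC_gen (c : ℕ) : (PiP : MvPolynomial α ℤ) = ThC c + DdC c := by
  unfold PiP ThC DdC bySize
  rw [← gf_union]
  · congr 1
    ext S
    simp only [mem_union, mem_filter, mem_powerset, subset_univ, true_and, true_iff]
    omega
  · rw [disjoint_left]
    intro S h1 h2
    have := (mem_filter.1 h1).2
    have := (mem_filter.1 h2).2
    omega

/-! ### The split identity and the reduction -/

/-- **THE LEVEL SPLIT `Ñ_c = Π·T_c + e_c·R_c`** (memo g23 §1; a polynomial identity, every `c`, every pair of families). [this work] -/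
theorem Ngen_eq_split (c : ℕ) (KX KZ : Finset (Finset α)) : Ngen c KX KZ = PiP * TcForm c KX KZ + ee c * RcForm c KX KZ := by
  unfold Ngen TcForm RcForm
  rw [gf_eq_facesLE_add_facesGT c KX, gf_eq_facesLE_add_facesGT c KZ, PiP_eq_ThC_add_DdC_gen (α := α) c]
  ring

/-- Coefficients of `Π`, `e_c`, `Θ_c`, `D_c` are nonnegative. [this work] -/
theorem coeff_PiP_ee_nonneg (c : ℕ) :
    (∀ m, 0 ≤ (PiP : MvPolynomial α ℤ).coeff m) ∧ (∀ m, 0 ≤ (ee c : MvPolynomial α ℤ).coeff m) ∧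
      (∀ m, 0 ≤ (ThC c : MvPolynomial α ℤ).coeff m) ∧ (∀ m, 0 ≤ (DdC c : MvPolynomial α ℤ).coeff m) := by
  refine ⟨fun m => ?_, fun m => ?_, fun m => ?_, fun m => ?_⟩
  · unfold PiP; exact coeff_gf_nonneg _ m
  · unfold ee; exact coeff_gf_nonneg _ m
  · unfold ThC; exact coeff_gf_nonneg _ m
  · unfold DdC; exact coeff_gf_nonneg _ m

/-- **REDUCTION**: if `T_c(K_X,K_Z)` and `R_c(K_X,K_Z)` have nonnegative coefficients, so has `Ñ_c(K_X,K_Z)`. [this work] -/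
theorem coeff_Ngen_nonneg_of_split {c : ℕ} {KX KZ : Finset (Finset α)} (hT : ∀ n, 0 ≤ (TcForm c KX KZ).coeff n)
    (hR : ∀ n, 0 ≤ (RcForm c KX KZ).coeff n) : ∀ n, 0 ≤ (Ngen c KX KZ).coeff n := by
  obtain ⟨hPi, hec, -, -⟩ := coeff_PiP_ee_nonneg (α := α) c
  intro n
  rw [Ngen_eq_split]
  exact cw_add (cw_mul hPi hT) (cw_mul hec hR) n

/-- The reduction at the VALUE level: `T_c, R_c ∈ ℕ[r]` ⇒ `Ñ_c(r) ≥ 0` at every `r ≥ 0` (the form in which `…SahiAllButC.rhoCert_allBut`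
consumes the (TC) row). [this work] -/
theorem eval_Ngen_nonneg_of_split {c : ℕ} {KX KZ : Finset (Finset α)} (hT : ∀ n, 0 ≤ (TcForm c KX KZ).coeff n)
    (hR : ∀ n, 0 ≤ (RcForm c KX KZ).coeff n) (r : α → ℝ) (hr : ∀ i, 0 ≤ r i) :
    0 ≤ eval₂ (Int.castRingHom ℝ) r (Ngen c KX KZ) := by
  have h := eval_le_of_coeff_le (P := (0 : MvPolynomial α ℤ)) (Q := Ngen c KX KZ)
    (fun m => by rw [coeff_zero]; exact coeff_Ngen_nonneg_of_split hT hR m) r hr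
  rwa [eval₂_zero] at h

/-! ### The easy cases of (LS_c) from the Harris block -/

/-- `h_K` is a down-set when `K` is. [this work] -/
theorem isLowerSet_facesLE (c : ℕ) {K : Finset (Finset α)} (hK : IsLowerSet (K : Set (Finset α))) :
    IsLowerSet ((facesLE c K : Finset (Finset α)) : Set (Finset α)) := by
  intro S T hTS hS
  rw [Finset.mem_coe] at hS ⊢
  simp only [facesLE, mem_filter, mem_powerset, subset_univ, true_and] at hS ⊢
  exact ⟨(card_le_card hTS).trans hS.1, hK hTS hS.2⟩

/-- `h_Y = h_X ∩ h_Z`. [this work] -/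
theorem commonLE_eq_inter (c : ℕ) (KX KZ : Finset (Finset α)) : commonLE c KX KZ = facesLE c KX ∩ facesLE c KZ := by
  ext S; simp only [commonLE, facesLE, mem_filter, mem_inter, mem_powerset, subset_univ, true_and]; tauto

/-- `K_X ∩ K_Z = h_Y` when `K_X` has no face of size `> c`. [this work] -/
theorem inter_eq_commonLE_of_facesGT_empty (c : ℕ) {KX KZ : Finset (Finset α)} (hX : facesGT c KX = ∅) :
    KX ∩ KZ = commonLE c KX KZ := by
  ext S; simp only [commonLE, mem_filter, mem_inter, mem_powerset, subset_univ, true_and]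
  constructor
  · rintro ⟨h1, h2⟩
    refine ⟨?_, h1, h2⟩
    by_contra hc
    have : S ∈ facesGT c KX := mem_filter.2 ⟨mem_powerset.2 (subset_univ _), by omega, h1⟩
    rw [hX] at this; simp at this
  · rintro ⟨_, h1, h2⟩; exact ⟨h1, h2⟩

/-- **`T_c ≥ 0` when the complexes share no `c`-face** (`e_Y = ∅`): then `T_c = e_c·(Π·h_Y − h_X·h_Z)` is `e_c` times a Harris block.
[this work] -/
theorem coeff_TcForm_nonneg_of_commonEQ_empty (c : ℕ) {KX KZ : Finset (Finset α)} (hKX : IsLowerSet (KX : Set (Finset α)))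
    (hKZ : IsLowerSet (KZ : Set (Finset α))) (hY : commonEQ c KX KZ = ∅) : ∀ n, 0 ≤ (TcForm c KX KZ).coeff n := by
  obtain ⟨-, hec, -, -⟩ := coeff_PiP_ee_nonneg (α := α) c
  have hH : ∀ m, 0 ≤ (PiP * gf (commonLE c KX KZ) - gf (facesLE c KX) * gf (facesLE c KZ) : MvPolynomial α ℤ).coeff m := by
    intro m; rw [commonLE_eq_inter]
    exact coeff_harris_sub_nonneg (isLowerSet_facesLE c hKX) (isLowerSet_facesLE c hKZ) m
  intro n
  unfold TcForm
  rw [hY]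
  have h0 : gf (∅ : Finset (Finset α)) = 0 := by unfold gf; simp
  simp only [h0, mul_zero, sub_zero]
  exact cw_mul hec hH n

/-- **`R_c ≥ 0` when neither complex has a face of size `> c`** (`t_X = t_Z = ∅`): then `K = h_K`, `K_X ∩ K_Z = h_Y` and
`R_c = D_c·(Π·GF(K_X ∩ K_Z) − K_X·K_Z)` is `D_c` times a Harris block. [this work] -/
theorem coeff_RcForm_nonneg_of_facesGT_empty (c : ℕ) {KX KZ : Finset (Finset α)} (hKX : IsLowerSet (KX : Set (Finset α)))
    (hKZ : IsLowerSet (KZ : Set (Finset α))) (hX : facesGT c KX = ∅) (hZ : facesGT c KZ = ∅) :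
    ∀ n, 0 ≤ (RcForm c KX KZ).coeff n := by
  obtain ⟨-, -, -, hDd⟩ := coeff_PiP_ee_nonneg (α := α) c
  have hH : ∀ m, 0 ≤ (PiP * gf (commonLE c KX KZ) - gf KX * gf KZ : MvPolynomial α ℤ).coeff m := by
    intro m; rw [← inter_eq_commonLE_of_facesGT_empty c hX]
    exact coeff_harris_sub_nonneg hKX hKZ m
  intro n
  unfold RcForm
  have h0 : gf (∅ : Finset (Finset α)) = 0 := by unfold gf; simp
  simp only [hX, hZ, h0, mul_zero, add_zero]
  exact cw_mul hDd hH n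

end Summit.CriticalPhenomena.PercolationContinuityZ3.Theorems.SahiCTCForms
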